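import Mathlib.NumberTheory.Zsqrtd.GaussianInt
import Summits.MatrixMultiplication.MatrixMultiplication.Theses.FidelityWitnesses
import Literature.Computability.AlgebraicComplexity.MatMulRankLowerBoundsBlaserProofs

/-!
# `FidelityWitnesses.RankThreeDefect` — super-additivity of fidelity starts at rank 3 over `ℂ`

Closes item `stmt-MatrixMultiplication-4965`
(`Summit.MatrixMultiplication.MatrixMultiplication.Theses.FidelityWitnesses.RankThreeDefect`):
there is a tensor `S` of rank `≤ 3` in the `2 × 2` format with
`3 · ‖S‖² < |⟨S, ⟨2,2,2⟩⟩|²`, i.e. fidelity ratio `> 3` (whereas for rank `≤ 2`, item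
`RankTwoAdditivity`, and over `ℝ` the ratio is at most the rank).

## Content

* `rankThreeDefect_of_certificate` — CERTIFICATE FORMAT: any three families of `2 × 2`
  Gaussian-integer matrices `w_l, u_l, v_l` (`l < 3`) whose tensor `S = Σ_l w_l ⊗ u_l ⊗ v_l` satisfies
  the integer inequality `3 · Σ N(S_{abc}) < N(⟨S, ⟨2,2,2⟩⟩)` over `ℤ[i]` (`N = Zsqrtd.norm`) yield
  `RankThreeDefect`, by transport along the ring homomorphism `GaussianInt.toComplex`: the rank does
  not increase under extension of scalars (`tensorRank_map_le`), `⟨2,2,2⟩` is defined over the prime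
  ring (`matMulTensor_map`), and `‖(z : ℂ)‖² = N(z)` (`GaussianInt.intCast_real_norm`).
* `rankThreeDefect_proof` — THE CERTIFICATE: explicit `w_l, u_l, v_l ∈ ℤ[i]^{2×2}` with entries of
  absolute value `≤ 22`, obtained by rounding at scale `22` a numerical optimiser of the fidelity
  ratio over rank-3 tensors (alternating exact least-squares elimination of one factor at a time
  converges to `3.005814959…`, agreeing with the four independent numerical confirmations recorded
  on the item).  For the rounded tensor
  `3 · ‖S‖² = 3 · 3914357652 = 11743072956 < 11748327650 = |⟨S, ⟨2,2,2⟩⟩|²` (ratio `3.00134…`),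
  an identity of integers checked by the kernel (`decide`).

No definitions are introduced; the witness lives inside the proof term.
-/

namespace Summit.MatrixMultiplication.MatrixMultiplication.Theorems

open scoped BigOperators
open Literature.Computability.AlgebraicComplexity

/-- **Certificate format for `RankThreeDefect`.** If three families `W U V : Fin 3 → ℤ[i]^{2×2}` of
Gaussian-integer matrices give a tensor `S = Σ_{l<3} W_l ⊗ U_l ⊗ V_l` (in the `(Fin 2 × Fin 2)^3`
format of `matMulTensor`) with `3 · Σ_{abc} N(S_{abc}) < N(Σ_{abc} S_{abc} · ⟨2,2,2⟩_{abc})` over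
`ℤ[i]`, then the complexified tensor `(S_{abc} : ℂ)` has rank `≤ 3` and fidelity ratio `> 3` (the
unfolded statement of `RankThreeDefect`).  Transport along `GaussianInt.toComplex` (`tensorRank_map_le`,
`matMulTensor_map`, `‖(z : ℂ)‖² = N(z)`). -/
theorem rankThreeDefect_of_certificate (W U V : Fin 3 → Fin 2 → Fin 2 → GaussianInt)
    (h : 3 * ∑ a, ∑ b, ∑ c,
        ((∑ l, triad (fun a => W l a.1 a.2) (fun b => U l b.1 b.2) (fun c => V l c.1 c.2) :
          Fin 2 × Fin 2 → Fin 2 × Fin 2 → Fin 2 × Fin 2 → GaussianInt) a b c).norm <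
      (∑ a, ∑ b, ∑ c,
        (∑ l, triad (fun a => W l a.1 a.2) (fun b => U l b.1 b.2) (fun c => V l c.1 c.2) :
          Fin 2 × Fin 2 → Fin 2 × Fin 2 → Fin 2 × Fin 2 → GaussianInt) a b c *
          matMulTensor GaussianInt 2 2 2 a b c).norm) :
    ∃ S : Fin 2 × Fin 2 → Fin 2 × Fin 2 → Fin 2 × Fin 2 → ℂ, tensorRank S ≤ 3 ∧
      3 * ∑ a, ∑ b, ∑ c, ‖S a b c‖ ^ 2 < ‖∑ a, ∑ b, ∑ c, S a b c * matMulTensor ℂ 2 2 2 a b c‖ ^ 2 := by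
  set S : Fin 2 × Fin 2 → Fin 2 × Fin 2 → Fin 2 × Fin 2 → GaussianInt :=
    ∑ l, triad (fun a => W l a.1 a.2) (fun b => U l b.1 b.2) (fun c => V l c.1 c.2) with hS
  refine ⟨fun a b c => GaussianInt.toComplex (S a b c), ?_, ?_⟩
  · -- rank ≤ 3: three explicit triads over ℤ[i], then extension of scalars
    exact (tensorRank_map_le GaussianInt.toComplex S).trans (tensorRank_le_of_eq_sum _ _ _ hS)
  · -- the inequality: move everything inside `toComplex`, then cast the integer inequality
    have hinner : (∑ a, ∑ b, ∑ c, GaussianInt.toComplex (S a b c) * matMulTensor ℂ 2 2 2 a b c)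
        = GaussianInt.toComplex (∑ a, ∑ b, ∑ c, S a b c * matMulTensor GaussianInt 2 2 2 a b c) := by
      rw [← matMulTensor_map GaussianInt.toComplex 2 2 2]
      simp only [map_sum, map_mul]
    rw [hinner]
    -- `‖(z : ℂ)‖² = N(z)` for Gaussian integers `z`
    simp only [Complex.sq_norm, ← GaussianInt.intCast_real_norm]
    exact_mod_cast h

/-- **`RankThreeDefect`** (item `stmt-MatrixMultiplication-4965`): some tensor of rank `≤ 3` in the
`2 × 2` format has fidelity ratio `> 3` against `⟨2,2,2⟩`.  The certificate: the Gaussian-integer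
triads below (entries of absolute value `≤ 22`, rounded from the numerical optimum `3.005814959…`),
for which `3 · ‖S‖² = 11743072956 < 11748327650 = |⟨S, ⟨2,2,2⟩⟩|²` (ratio `3.00134…`) is decided
by the kernel over `ℤ[i]`. -/
theorem rankThreeDefect_proof :
    Summit.MatrixMultiplication.MatrixMultiplication.Theses.FidelityWitnesses.RankThreeDefect := by
  unfold Summit.MatrixMultiplication.MatrixMultiplication.Theses.FidelityWitnesses.RankThreeDefect
  exact rankThreeDefect_of_certificate
    ![![![⟨19, 10⟩, ⟨-1, 3⟩], ![⟨5, -7⟩, ⟨-20, 3⟩]],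
      ![![⟨2, 18⟩, ⟨-16, 3⟩], ![⟨-12, -7⟩, ⟨11, -19⟩]],
      ![![⟨8, -18⟩, ⟨0, -20⟩], ![⟨9, 9⟩, ⟨22, 0⟩]]]
    ![![![⟨15, -13⟩, ⟨-4, -20⟩], ![⟨22, 0⟩, ⟨20, -2⟩]],
      ![![⟨-9, -1⟩, ⟨-18, 8⟩], ![⟨14, 2⟩, ⟨22, 0⟩]],
      ![![⟨22, 0⟩, ⟨7, -11⟩], ![⟨7, -17⟩, ⟨-2, -8⟩]]]
    ![![![⟨22, 0⟩, ⟨-11, 8⟩], ![⟨18, 10⟩, ⟨-14, -1⟩]],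
      ![![⟨-7, 15⟩, ⟨8, -5⟩], ![⟨-10, 18⟩, ⟨22, 0⟩]],
      ![![⟨22, 0⟩, ⟨10, 18⟩], ![⟨11, 5⟩, ⟨-8, 9⟩]]]
    (by decide +kernel)

end Summit.MatrixMultiplication.MatrixMultiplication.Theorems
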